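import Mathlib.Algebra.Algebra.RestrictScalars
import Mathlib.RingTheory.TensorProduct.Basic
import Summits.Ventures.HodgeRepro2.HostAPI.Carriers.AlgebraicGeometry.HodgeTheory.AlgebraicClasses
import Summits.Ventures.HodgeRepro2.HostAPI.Carriers.AlgebraicGeometry.HodgeTheory.RationalHodgeClasses

/-!
# T6HostCoeff — the change of coefficients `ℚ → ℂ` on the host's singular cohomology

Cell pub-hodge-repro2, Tier 6 (README §10), seat t6-p2 (lead's ask STATUS l. 10912 (2)(ii) / (4)). The host
package carries singular cohomology with coefficients `ℚ` (`bettiCohomology`, the Weil-cohomology side) and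
with coefficients `ℂ` (`complexBetti`, the side of `HCCM.Statement`), but NO map between them: `IsRationalClass`
is a cocycle-level condition. This file CONSTRUCTS the coefficient map from the cochain complexes:
* `ratCochain φ := algebraMap ℚ ℂ ∘ φ` commutes with the differential (`d_ratCochain`); `ratCocycle` on cocycles;
* `coeffRat Y n : singularCohomology ℚ ℚ Y n →ₗ[ℚ] singularCohomology ℂ ℂ Y n` (the target restricted to `ℚ`),
  by the universal property of the cokernel `homologyπ` (the host's own `homologyIsCokernel` pattern);
* **`coeffC Y n : ℂ ⊗[ℚ] singularCohomology ℚ ℚ Y n →ₗ[ℂ] singularCohomology ℂ ℂ Y n`**, its `ℂ`-linear extension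
  (`LinearMap.liftBaseChange`), with `coeffC_one_tmul_π` (`1 ⊗ [z] ↦ [algebraMap ∘ z]`) and `coeffC_ext`;
* its properties: `isRationalClass_coeffC_one_tmul` and `exists_coeffC_one_tmul_eq_of_isRationalClass` (the
  image of `1 ⊗ -` IS `IsRationalClass`), `map_coeffC_one_tmul` (naturality in continuous maps),
  `coeffC_cupProduct` (multiplicativity), and `coeffC_one_tmul_mem_supportedClasses_of_mem_coniveau`
  (the host's `coniveau` goes to its `supportedClasses`).
No display, no `sorry`; standard axioms. §8(d): uses an L-value-free non-vanishing device: NO.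
-/

noncomputable section

namespace Summit.Ventures.HodgeRepro2.T6.HostCoeff

open HostAPI.Carriers.AlgebraicTopology.SingularHomology CategoryTheory Limits
open scoped TensorProduct

universe u

variable {Y : Type u} [TopologicalSpace Y]

section cochain

variable {n : ℕ}

/-- the change of coefficients on cochains: `φ ↦ algebraMap ℚ ℂ ∘ φ` -/
def ratCochain (φ : SingularSimplex Y n → ℚ) : SingularSimplex Y n → ℂ := fun σ => (φ σ : ℂ)

/-- `ratCochain`, pointwise -/
theorem ratCochain_apply (φ : SingularSimplex Y n → ℚ) (σ : SingularSimplex Y n) : ratCochain φ σ = (φ σ : ℂ) := rfl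

/-- `ratCochain` sends the zero cochain to the zero cochain -/
theorem ratCochain_zero : ratCochain (0 : SingularSimplex Y n → ℚ) = 0 := by
  funext σ; simp [ratCochain]

/-- `ratCochain` is additive -/
theorem ratCochain_add (φ ψ : SingularSimplex Y n → ℚ) : ratCochain (φ + ψ) = ratCochain φ + ratCochain ψ := by
  funext σ; simp [ratCochain]

/-- `ratCochain` is `ℚ`-linear (rational scalars act through `algebraMap ℚ ℂ`) -/
theorem ratCochain_smul (r : ℚ) (φ : SingularSimplex Y n → ℚ) : ratCochain (r • φ) = (r : ℂ) • ratCochain φ := by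
  funext σ; simp [ratCochain]

/-- `ratCochain` is injective (`Rat.cast` is injective) -/
theorem ratCochain_injective : Function.Injective (ratCochain (Y := Y) (n := n)) := by
  intro φ ψ h
  funext σ
  exact Rat.cast_injective (congrFun h σ)

/-- the change of coefficients commutes with the differential (adjacent degrees) -/
theorem d_ratCochain (φ : SingularSimplex Y n → ℚ) :
    (singularCochainComplex ℂ ℂ Y).d n (n + 1) (ratCochain φ) =
      ratCochain ((singularCochainComplex ℚ ℚ Y).d n (n + 1) φ) := by
  refine singularCochainComplex.ext fun σ => ?_
  change (singularCochainComplex ℂ ℂ Y).d n (n + 1) (ratCochain φ) σ =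
    (((singularCochainComplex ℚ ℚ Y).d n (n + 1) φ σ : ℚ) : ℂ)
  rw [singularCochainComplex.d_apply, singularCochainComplex.d_apply, Rat.cast_sum]
  refine Finset.sum_congr rfl fun i _ => ?_
  rw [smul_eq_mul, smul_eq_mul, Rat.cast_mul, ratCochain_apply]
  push_cast
  ring

/-- the change of coefficients commutes with every differential `d i j` -/
theorem d_ratCochain' (i j : ℕ) (φ : SingularSimplex Y i → ℚ) :
    (singularCochainComplex ℂ ℂ Y).d i j (ratCochain φ) = ratCochain ((singularCochainComplex ℚ ℚ Y).d i j φ) := by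
  by_cases h : (ComplexShape.up ℕ).Rel i j
  · change i + 1 = j at h
    subst h
    exact d_ratCochain φ
  · rw [HomologicalComplex.shape _ _ _ h, HomologicalComplex.shape _ _ _ h]
    change (0 : SingularSimplex Y j → ℂ) = ratCochain 0
    rw [ratCochain_zero]

/-- the change of coefficients of a cocycle is a cocycle -/
theorem d_ratCochain_iCocycles (z : singularCochainComplex.cocycles ℚ ℚ Y n) :
    (singularCochainComplex ℂ ℂ Y).d n (n + 1) (ratCochain (singularCochainComplex.iCocycles ℚ ℚ Y n z)) = 0 := by
  rw [d_ratCochain]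
  have h : (singularCochainComplex ℚ ℚ Y).d n (n + 1) (singularCochainComplex.iCocycles ℚ ℚ Y n z) = 0 :=
    singularCochainComplex.d_iCocycles _ _
  rw [h]
  exact ratCochain_zero

/-- the change of coefficients on cocycles -/
def ratCocycle (z : singularCochainComplex.cocycles ℚ ℚ Y n) : singularCochainComplex.cocycles ℂ ℂ Y n :=
  singularCochainComplex.cocyclesMk (R := ℂ) (M := ℂ) (X := Y) (n := n)
    (ratCochain (singularCochainComplex.iCocycles ℚ ℚ Y n z)) (d_ratCochain_iCocycles z)

/-- the underlying cochain of `ratCocycle z` is `ratCochain` of the underlying cochain of `z` -/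
@[simp]
theorem iCocycles_ratCocycle (z : singularCochainComplex.cocycles ℚ ℚ Y n) :
    singularCochainComplex.iCocycles ℂ ℂ Y n (ratCocycle z) = ratCochain (singularCochainComplex.iCocycles ℚ ℚ Y n z) :=
  singularCochainComplex.iCocycles_mk _ (d_ratCochain_iCocycles z)

/-- `ratCocycle` is additive -/
theorem ratCocycle_add (z z' : singularCochainComplex.cocycles ℚ ℚ Y n) :
    ratCocycle (z + z') = ratCocycle z + ratCocycle z' := by
  refine singularCochainComplex.cocycles_ext ?_
  rw [map_add, iCocycles_ratCocycle, iCocycles_ratCocycle, iCocycles_ratCocycle, map_add]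
  exact ratCochain_add _ _

/-- `ratCocycle` is `ℚ`-linear -/
theorem ratCocycle_smul (r : ℚ) (z : singularCochainComplex.cocycles ℚ ℚ Y n) :
    ratCocycle (r • z) = (r : ℂ) • ratCocycle z := by
  refine singularCochainComplex.cocycles_ext ?_
  rw [map_smul, iCocycles_ratCocycle, iCocycles_ratCocycle, map_smul]
  exact ratCochain_smul _ _

/-- the change of coefficients sends coboundaries to coboundaries -/
theorem ratCocycle_toCocycles (i : ℕ) (φ : (singularCochainComplex ℚ ℚ Y).X i) :
    ratCocycle (singularCochainComplex.toCocycles ℚ ℚ Y i n φ) =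
      singularCochainComplex.toCocycles ℂ ℂ Y i n (ratCochain φ) := by
  refine singularCochainComplex.cocycles_ext ?_
  rw [iCocycles_ratCocycle, singularCochainComplex.iCocycles_toCocycles,
    singularCochainComplex.iCocycles_toCocycles, d_ratCochain']

end cochain

section cohomology

variable (Y) (n : ℕ)

attribute [local instance] RestrictScalars.moduleOrig

/-- the `ℂ`-cohomology as a `ℚ`-module (restriction of scalars along `ℚ → ℂ`) — a notation, so that
instance search sees `RestrictScalars` directly -/
local notation "HCQ" Y:max n:max => RestrictScalars ℚ ℂ (singularCohomology ℂ ℂ Y n)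

/-- the `ℚ`-module structure of the restricted `ℂ`-cohomology (Mathlib's `RestrictScalars.module`, restated so
that instance search finds it at once) -/
instance instModuleRatHCQ : Module ℚ (HCQ Y n) := RestrictScalars.module ℚ ℂ _

/-- the original `ℂ`-module structure of the restricted `ℂ`-cohomology -/
instance instModuleComplexHCQ : Module ℂ (HCQ Y n) := RestrictScalars.moduleOrig ℚ ℂ _

/-- the scalar tower `ℚ → ℂ` on the restricted `ℂ`-cohomology -/
instance instIsScalarTowerHCQ : IsScalarTower ℚ ℂ (HCQ Y n) := RestrictScalars.isScalarTower ℚ ℂ _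

/-- the cocycle-level map into the `ℂ`-cohomology, as a `ℚ`-linear map -/
def coeffCocycles : singularCochainComplex.cocycles ℚ ℚ Y n →ₗ[ℚ] HCQ Y n where
  toFun z := (RestrictScalars.addEquiv ℚ ℂ _).symm (singularCohomology.π ℂ ℂ Y n (ratCocycle z))
  map_add' z z' := by
    rw [ratCocycle_add, map_add, map_add]
  map_smul' r z := by
    rw [ratCocycle_smul, RingHom.id_apply]
    change (RestrictScalars.addEquiv ℚ ℂ _).symm ((singularCohomology.π ℂ ℂ Y n).hom ((r : ℂ) • ratCocycle z)) = _
    rw [map_smul]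
    rfl

/-- `coeffCocycles`, unfolded -/
theorem coeffCocycles_apply (z : singularCochainComplex.cocycles ℚ ℚ Y n) :
    coeffCocycles Y n z = (RestrictScalars.addEquiv ℚ ℂ _).symm (singularCohomology.π ℂ ℂ Y n (ratCocycle z)) := rfl

/-- the restricted `ℂ`-cohomology as an object of `ModuleCat ℚ` (the `ℚ`-module instance passed explicitly:
instance search does not find it under the coercion of the carrier) -/
def HCQMod : ModuleCat ℚ := @ModuleCat.of ℚ _ (HCQ Y n) _ (instModuleRatHCQ Y n)

/-- the cocycle-level map as a morphism of `ModuleCat ℚ` -/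
def coeffCocyclesHom : singularCochainComplex.cocycles ℚ ℚ Y n ⟶ HCQMod Y n :=
  @ModuleCat.ofHom ℚ _ _ (HCQ Y n) _ _ _ (instModuleRatHCQ Y n) (coeffCocycles Y n)

/-- `coeffCocyclesHom`, pointwise -/
theorem coeffCocyclesHom_apply (z : singularCochainComplex.cocycles ℚ ℚ Y n) :
    coeffCocyclesHom Y n z = coeffCocycles Y n z := rfl

/-- the cocycle-level map kills the coboundaries -/
theorem toCocycles_comp_coeffCocycles :
    singularCochainComplex.toCocycles ℚ ℚ Y ((ComplexShape.up ℕ).prev n) n ≫ coeffCocyclesHom Y n = 0 := by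
  refine ModuleCat.hom_ext (LinearMap.ext fun φ => ?_)
  change coeffCocycles Y n (singularCochainComplex.toCocycles ℚ ℚ Y _ n φ) = 0
  rw [coeffCocycles_apply, ratCocycle_toCocycles, singularCochainComplex.π_toCocycles, map_zero]

/-- THE CHANGE OF COEFFICIENTS ON COHOMOLOGY, `ℚ`-linear: the universal property of `homologyπ`
(the host's `homologyIsCokernel`). -/
def coeffRatHom : singularCohomology ℚ ℚ Y n ⟶ HCQMod Y n :=
  Cofork.IsColimit.desc ((singularCochainComplex ℚ ℚ Y).homologyIsCokernel ((ComplexShape.up ℕ).prev n) n rfl)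
    (coeffCocyclesHom Y n) (by rw [zero_comp]; exact toCocycles_comp_coeffCocycles Y n)

/-- `coeffRatHom` on the class of a cocycle -/
theorem coeffRatHom_π (z : singularCochainComplex.cocycles ℚ ℚ Y n) :
    coeffRatHom Y n (singularCohomology.π ℚ ℚ Y n z) = coeffCocycles Y n z := by
  have e := Cofork.IsColimit.π_desc'
    ((singularCochainComplex ℚ ℚ Y).homologyIsCokernel ((ComplexShape.up ℕ).prev n) n rfl)
    (coeffCocyclesHom Y n) (by rw [zero_comp]; exact toCocycles_comp_coeffCocycles Y n)
  exact congr($e z)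

/-- the change of coefficients on cohomology, as a `ℚ`-linear map -/
def coeffRat : singularCohomology ℚ ℚ Y n →ₗ[ℚ] HCQ Y n := (coeffRatHom Y n).hom

/-- `coeffRat` on the class of a cocycle `z` is the class of `ratCocycle z` -/
theorem coeffRat_π (z : singularCochainComplex.cocycles ℚ ℚ Y n) :
    coeffRat Y n (singularCohomology.π ℚ ℚ Y n z) =
      (RestrictScalars.addEquiv ℚ ℂ _).symm (singularCohomology.π ℂ ℂ Y n (ratCocycle z)) :=
  coeffRatHom_π Y n z

/-- the identity `RestrictScalars ℚ ℂ M → M` as a `ℂ`-linear map -/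
def toOrig (M : Type*) [AddCommGroup M] [Module ℂ M] : RestrictScalars ℚ ℂ M →ₗ[ℂ] M where
  toFun := RestrictScalars.addEquiv ℚ ℂ M
  map_add' _ _ := rfl
  map_smul' _ _ := rfl

/-- **THE CHANGE OF COEFFICIENTS `ℚ → ℂ`, `ℂ`-linear**: `ℂ ⊗[ℚ] H^n(Y; ℚ) → H^n(Y; ℂ)`. -/
def coeffC : ℂ ⊗[ℚ] singularCohomology ℚ ℚ Y n →ₗ[ℂ] singularCohomology ℂ ℂ Y n :=
  (toOrig _).comp (LinearMap.liftBaseChange ℂ (coeffRat Y n))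

/-- `coeffC` on a pure tensor -/
theorem coeffC_tmul (c : ℂ) (x : singularCohomology ℚ ℚ Y n) :
    coeffC Y n (c ⊗ₜ x) = c • (RestrictScalars.addEquiv ℚ ℂ _ (coeffRat Y n x)) := by
  simp only [coeffC, LinearMap.comp_apply, LinearMap.liftBaseChange_tmul]
  rfl

/-- `coeffC (1 ⊗ [z]) = [algebraMap ℚ ℂ ∘ z]` -/
theorem coeffC_one_tmul_π (z : singularCochainComplex.cocycles ℚ ℚ Y n) :
    coeffC Y n (1 ⊗ₜ singularCohomology.π ℚ ℚ Y n z) = singularCohomology.π ℂ ℂ Y n (ratCocycle z) := by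
  rw [coeffC_tmul, coeffRat_π, one_smul]
  rfl

/-- a `ℂ`-linear map out of `ℂ ⊗[ℚ] H^n(Y; ℚ)` is determined by its values on `1 ⊗ [z]` -/
theorem coeffC_ext {N : Type*} [AddCommGroup N] [Module ℚ N] [Module ℂ N] [IsScalarTower ℚ ℂ N]
    {f g : ℂ ⊗[ℚ] singularCohomology ℚ ℚ Y n →ₗ[ℂ] N}
    (h : ∀ z : singularCochainComplex.cocycles ℚ ℚ Y n,
      f (1 ⊗ₜ singularCohomology.π ℚ ℚ Y n z) = g (1 ⊗ₜ singularCohomology.π ℚ ℚ Y n z)) : f = g := by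
  apply (LinearMap.liftBaseChangeEquiv ℂ).symm.injective
  refine LinearMap.ext fun x => ?_
  simp only [LinearMap.liftBaseChangeEquiv_symm_apply]
  induction x using singularCohomology_induction_on with
  | h z => exact h z

end cohomology

section properties

open HostAPI.Carriers.AlgebraicGeometry.HodgeTheory

variable (Y) (n : ℕ)

/-- the image of `1 ⊗ x` is a rational class -/
theorem isRationalClass_coeffC_one_tmul (x : singularCohomology ℚ ℚ Y n) :
    IsRationalClass (coeffC Y n (1 ⊗ₜ x)) := by
  induction x using singularCohomology_induction_on with
  | h z =>
    refine ⟨ratCocycle z, (coeffC_one_tmul_π Y n z).symm, fun σ => ?_⟩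
    rw [iCocycles_ratCocycle, ratCochain_apply]
    exact ⟨_, (eq_ratCast (algebraMap ℚ ℂ) _).symm⟩

/-- every rational class is `coeffC (1 ⊗ x)` for some `x` -/
theorem exists_coeffC_one_tmul_eq_of_isRationalClass {c : singularCohomology ℂ ℂ Y n} (hc : IsRationalClass c) :
    ∃ x : singularCohomology ℚ ℚ Y n, coeffC Y n (1 ⊗ₜ x) = c := by
  obtain ⟨z', hz', hrat⟩ := hc
  classical
  -- the rational values of `z'`
  let φ : SingularSimplex Y n → ℚ := fun σ => (hrat σ).choose
  have hφ : ratCochain φ = singularCochainComplex.iCocycles ℂ ℂ Y n z' := by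
    funext σ
    rw [ratCochain_apply, ← eq_ratCast (algebraMap ℚ ℂ)]
    exact (hrat σ).choose_spec
  have hd : (singularCochainComplex ℚ ℚ Y).d n (n + 1) φ = 0 := by
    apply ratCochain_injective
    rw [← d_ratCochain, hφ, singularCochainComplex.d_iCocycles]
    exact ratCochain_zero.symm
  refine ⟨singularCohomology.π ℚ ℚ Y n (singularCochainComplex.cocyclesMk φ hd), ?_⟩
  rw [coeffC_one_tmul_π, ← hz']
  congr 1
  refine singularCochainComplex.cocycles_ext ?_
  rw [iCocycles_ratCocycle, singularCochainComplex.iCocycles_mk, hφ]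

variable {Y}

/-- NATURALITY: the change of coefficients commutes with the pull-back along a continuous map -/
theorem map_coeffC_one_tmul {Y' : Type u} [TopologicalSpace Y'] (f : C(Y', Y)) (x : singularCohomology ℚ ℚ Y n) :
    singularCohomology.map ℂ ℂ f n (coeffC Y n (1 ⊗ₜ x)) = coeffC Y' n (1 ⊗ₜ singularCohomology.map ℚ ℚ f n x) := by
  induction x using singularCohomology_induction_on with
  | h z =>
    rw [coeffC_one_tmul_π, singularCohomology.map_π, singularCohomology.map_π, coeffC_one_tmul_π]
    congr 1
    refine singularCochainComplex.cocycles_ext ?_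
    rw [iCocycles_ratCocycle, singularCochainComplex.iCocycles_cocyclesMap,
      singularCochainComplex.iCocycles_cocyclesMap, iCocycles_ratCocycle]
    rfl

/-- MULTIPLICATIVITY: the change of coefficients commutes with the cup product -/
theorem coeffC_cupProduct {p q : ℕ} (h : p + q = n) (x : singularCohomology ℚ ℚ Y p) (y : singularCohomology ℚ ℚ Y q) :
    coeffC Y n (1 ⊗ₜ cupProduct h x y) = cupProduct h (coeffC Y p (1 ⊗ₜ x)) (coeffC Y q (1 ⊗ₜ y)) := by
  induction x using singularCohomology_induction_on with
  | h a =>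
    induction y using singularCohomology_induction_on with
    | h b =>
      rw [cupProduct_π_π, coeffC_one_tmul_π, coeffC_one_tmul_π, coeffC_one_tmul_π, cupProduct_π_π]
      congr 1
      refine singularCochainComplex.cocycles_ext ?_
      rw [iCocycles_ratCocycle, singularCochainComplex.iCocycles_cocyclesCup,
        singularCochainComplex.iCocycles_cocyclesCup, iCocycles_ratCocycle, iCocycles_ratCocycle]
      funext σ
      simp [ratCochain_apply, cochainCup_apply]

end properties

section coniveau

open HostAPI.Carriers.AlgebraicGeometry.Motives HostAPI.Carriers.AlgebraicGeometry.HodgeTheory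

variable (X : SchemeOver ℂ)

/-- the host's `coniveau` (on `ℚ`-Betti cohomology) goes into its `supportedClasses` (on `ℂ`-Betti cohomology) -/
theorem coeffC_one_tmul_mem_supportedClasses_of_mem_coniveau (i r : ℕ) {x : bettiCohomology X i}
    (hx : x ∈ coniveau X i r) : coeffC (ComplexPoints X) i (1 ⊗ₜ x) ∈ supportedClasses X i r := by
  unfold coniveau at hx
  let C : bettiCohomology X i → Prop := fun x => coeffC (ComplexPoints X) i (1 ⊗ₜ x) ∈ supportedClasses X i r
  have hzero : C 0 := by
    show coeffC (ComplexPoints X) i (1 ⊗ₜ (0 : bettiCohomology X i)) ∈ supportedClasses X i r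
    rw [TensorProduct.tmul_zero, map_zero]; exact zero_mem _
  have hadd : ∀ x y, C x → C y → C (x + y) := fun x y hx hy => by
    show coeffC (ComplexPoints X) i (1 ⊗ₜ (x + y)) ∈ supportedClasses X i r
    rw [TensorProduct.tmul_add, map_add]; exact add_mem hx hy
  refine Submodule.iSup_induction (motive := C) _ hx (fun Z x hx => ?_) hzero hadd
  refine Submodule.iSup_induction (motive := C) _ hx (fun hZ x hx => ?_) hzero hadd
  refine Submodule.iSup_induction (motive := C) _ hx (fun hr x hx => ?_) hzero hadd
  refine mem_supportedClasses_of_restrictCompl_eq_zero hZ hr ?_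
  have h0 : bettiCohomology.restrictCompl X Z i x = 0 := hx
  exact (map_coeffC_one_tmul i (⟨Subtype.val, continuous_subtype_val⟩ :
    C(complexPointsCompl X Z, ComplexPoints X)) x).trans
    (by rw [h0, TensorProduct.tmul_zero, map_zero])

end coniveau

end Summit.Ventures.HodgeRepro2.T6.HostCoeff

end
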